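import Summits.Ventures.CertifiedManyBodySolver.Theorems.M3x2EdgeSplitSymReplayPackedHB
import Mathlib.Data.List.Sort
import HarnessLib

/-!
# SymReplay — THEORY OF THE PACKED COLLECTOR, part 1: `pwordLt` is a strict total order; `psortW` is a sorted permutation

(team lb-sym, cell hub-lb; hub-lb-sym-eng-4 g3, 2026-08-28; module 1 of 4 of lever (α-T) «ordered-map collector», EBUDGET-600
§10/§11 row (α); ADDITIVE on `…PackedNF/…PackedHB`; nothing landed is touched.)

* (a) `pwordEq ↔ =`; `pwordLt` is irreflexive, transitive, total, asymmetric; the collector's merge order `ple t t' := !pwordLt t'.2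
  t.2` is total and transitive.
* (b) `pmergeF n p q = List.merge p q ple` whenever the fuel covers `|p| + |q|` (`pmergeF_eq_merge`), hence the fuel-structural
  bottom-up merge sort of record `psortW` is a PERMUTATION (`psortW_perm`) and SORTED (`psortW_sorted`, via core
  `List.pairwise_merge` and a halving argument on the work-list `pmergePairs`/`pmergeAll`).
Parts 2–4: `…PackedCollect` (word sums, `pmergeAdj`, uniqueness of collected forms), `…PackedKey` (one-integer word keys),
`…PackedCollectT` (the `Std.TreeMap` collector and `pcollectT_eq : pcollectT = pcollect2`).

HONEST FRAMING: list theory about an existing executable / an interpreted replay-COST lever; certifies nothing; no bound of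
record moves; no summit or crux statement is proved here; nothing here predicts superconductivity.
-/

namespace Summit.Ventures.CertifiedManyBodySolver.Theorems.SymReplay.PackedNF

open Summit.Ventures.CertifiedManyBodySolver.Theorems.SymReplay

/-! ##### (a) `pwordEq`, `pwordLt` as an order; the merge order `ple` -/

/-- `pwordEq` decides equality of packed words. -/
theorem pwordEq_eq_true_iff : ∀ (u v : PWord), pwordEq u v = true ↔ u = v
  | [], [] => by simp [pwordEq]
  | [], b :: v => by simp [pwordEq]
  | a :: u, [] => by simp [pwordEq]
  | a :: u, b :: v => by simp [pwordEq, pwordEq_eq_true_iff u v]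

/-- `pwordEq` is `false` exactly on distinct words. -/
theorem pwordEq_eq_false_iff (u v : PWord) : pwordEq u v = false ↔ u ≠ v := by
  rw [← Bool.not_eq_true, pwordEq_eq_true_iff]

/-- `pwordEq` is reflexive. -/
theorem pwordEq_refl (u : PWord) : pwordEq u u = true := (pwordEq_eq_true_iff u u).2 rfl

/-- `pwordLt` is irreflexive. -/
theorem pwordLt_irrefl : ∀ (u : PWord), pwordLt u u = false
  | [] => rfl
  | a :: u => by simp [pwordLt, pwordLt_irrefl u]

/-- `pwordLt` is transitive. -/
theorem pwordLt_trans : ∀ (u v w : PWord), pwordLt u v = true → pwordLt v w = true → pwordLt u w = true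
  | [], [], w, h, _ => by simp [pwordLt] at h
  | [], b :: v, [], _, h => by simp [pwordLt] at h
  | [], b :: v, c :: w, _, _ => by simp [pwordLt]
  | a :: u, [], w, h, _ => by simp [pwordLt] at h
  | a :: u, b :: v, [], _, h => by simp [pwordLt] at h
  | a :: u, b :: v, c :: w, h1, h2 => by
    simp only [pwordLt, Bool.or_eq_true, decide_eq_true_eq, Bool.and_eq_true, beq_iff_eq] at h1 h2 ⊢
    rcases h1 with h1 | ⟨rfl, h1⟩ <;> rcases h2 with h2 | ⟨rfl, h2⟩
    · exact Or.inl (lt_trans h1 h2)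
    · exact Or.inl h1
    · exact Or.inl h2
    · exact Or.inr ⟨rfl, pwordLt_trans u v w h1 h2⟩

/-- `pwordLt` is total (trichotomy). -/
theorem pwordLt_total : ∀ (u v : PWord), pwordLt u v = true ∨ u = v ∨ pwordLt v u = true
  | [], [] => Or.inr (Or.inl rfl)
  | [], b :: v => Or.inl rfl
  | a :: u, [] => Or.inr (Or.inr rfl)
  | a :: u, b :: v => by
    rcases lt_trichotomy a b with h | rfl | h
    · exact Or.inl (by simp [pwordLt, h])
    · rcases pwordLt_total u v with h | rfl | h
      · exact Or.inl (by simp [pwordLt, h])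
      · exact Or.inr (Or.inl rfl)
      · exact Or.inr (Or.inr (by simp [pwordLt, h]))
    · exact Or.inr (Or.inr (by simp [pwordLt, h]))

/-- `pwordLt` is asymmetric. -/
theorem pwordLt_asymm (u v : PWord) (h : pwordLt u v = true) : pwordLt v u = false := by
  cases h' : pwordLt v u
  · rfl
  · have h'' := pwordLt_trans u v u h h'
    rw [pwordLt_irrefl] at h''
    exact h''.symm

/-- A strictly smaller word is a different word. -/
theorem ne_of_pwordLt {u v : PWord} (h : pwordLt u v = true) : u ≠ v := by
  rintro rfl; rw [pwordLt_irrefl] at h; exact Bool.false_ne_true h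

/-- **The merge order** of the collector: `t` may precede `t'` (not `t'.2 < t.2`). -/
def ple (t t' : ℚ × PWord) : Bool := !pwordLt t'.2 t.2

/-- `ple` is total. -/
theorem ple_total (a b : ℚ × PWord) : (ple a b || ple b a) = true := by
  unfold ple
  rcases pwordLt_total a.2 b.2 with h | h | h
  · rw [pwordLt_asymm _ _ h]; simp
  · rw [h, pwordLt_irrefl]; simp
  · rw [pwordLt_asymm _ _ h]; simp

/-- `ple` is transitive. -/
theorem ple_trans (a b c : ℚ × PWord) (h1 : ple a b = true) (h2 : ple b c = true) : ple a c = true := by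
  unfold ple at h1 h2 ⊢
  rw [Bool.not_eq_true'] at h1 h2 ⊢
  cases hca : pwordLt c.2 a.2
  · rfl
  · exfalso
    rcases pwordLt_total a.2 b.2 with hab | hab | hab
    · rw [pwordLt_trans _ _ _ hca hab] at h2; exact Bool.noConfusion h2
    · rw [hab] at hca; rw [hca] at h2; exact Bool.noConfusion h2
    · rw [hab] at h1; exact Bool.noConfusion h1

/-! ##### (b) `psortW` is the iterated core merge: permutation and sortedness -/

/-- **`pmergeF` IS core `List.merge`** when the fuel covers both lists. -/
theorem pmergeF_eq_merge : ∀ (n : ℕ) (p q : PPoly), p.length + q.length ≤ n → pmergeF n p q = List.merge p q ple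
  | 0, p, q, h => by
    have hp : p = [] := List.eq_nil_of_length_eq_zero (by omega)
    have hq : q = [] := List.eq_nil_of_length_eq_zero (by omega)
    subst hp hq
    simp [pmergeF]
  | n + 1, [], q, _ => by simp [pmergeF]
  | n + 1, t :: p, [], _ => by simp [pmergeF]
  | n + 1, t :: p, t' :: q, h => by
    rw [pmergeF, List.cons_merge_cons]
    by_cases hlt : pwordLt t'.2 t.2 = true
    · have hple : ple t t' = false := by simp [ple, hlt]
      rw [if_pos hlt, hple, pmergeF_eq_merge n (t :: p) q (by simp only [List.length_cons] at h ⊢; omega)]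
      simp
    · have hple : ple t t' = true := by simpa [ple] using hlt
      rw [if_neg hlt, hple, if_pos rfl, pmergeF_eq_merge n p (t' :: q) (by simp only [List.length_cons] at h ⊢; omega)]

/-- `pmergeF` is a permutation of the concatenation (any fuel). -/
theorem pmergeF_perm : ∀ (n : ℕ) (p q : PPoly), (pmergeF n p q).Perm (p ++ q)
  | 0, p, q => by simp [pmergeF]
  | n + 1, [], q => by simp [pmergeF]
  | n + 1, t :: p, [] => by simp [pmergeF]
  | n + 1, t :: p, t' :: q => by
    rw [pmergeF]
    split_ifs with h
    · exact ((pmergeF_perm n (t :: p) q).cons t').trans List.perm_middle.symm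
    · exact (pmergeF_perm n p (t' :: q)).cons t

/-- One pairing round is a permutation of the flattened work-list. -/
theorem pmergePairs_flatten_perm (n : ℕ) : ∀ (L : List PPoly), (pmergePairs n L).flatten.Perm L.flatten
  | [] => List.Perm.refl _
  | [p] => List.Perm.refl _
  | p :: q :: rest => by
    rw [pmergePairs, List.flatten_cons, List.flatten_cons, List.flatten_cons, ← List.append_assoc]
    exact (pmergeF_perm n p q).append (pmergePairs_flatten_perm n rest)

/-- `foldr (++) []` is `flatten`. -/
theorem foldr_append_nil_eq_flatten : ∀ (L : List PPoly), L.foldr (· ++ ·) [] = L.flatten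
  | [] => rfl
  | l :: L => by rw [List.foldr_cons, List.flatten_cons, foldr_append_nil_eq_flatten L]

/-- The merge-sort driver is a permutation of the flattened work-list. -/
theorem pmergeAll_perm : ∀ (k n : ℕ) (L : List PPoly), (pmergeAll k n L).Perm L.flatten
  | 0, n, [] => by simp [pmergeAll]
  | 0, n, [p] => by simp [pmergeAll]
  | 0, n, p :: q :: rest => by
    rw [pmergeAll, foldr_append_nil_eq_flatten]
    · intro h; simp at h
    · intro p' h; simp at h
  | k + 1, n, [] => by simp [pmergeAll]
  | k + 1, n, [p] => by simp [pmergeAll]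
  | k + 1, n, p :: q :: rest => by
    rw [pmergeAll]
    · exact (pmergeAll_perm k n _).trans (pmergePairs_flatten_perm n _)
    · intro h; simp at h
    · intro p' h; simp at h

/-- Flattening singletons. -/
theorem flatten_map_singleton : ∀ (p : PPoly), (p.map fun t => [t]).flatten = p
  | [] => rfl
  | t :: p => by rw [List.map_cons, List.flatten_cons, flatten_map_singleton p]; rfl

/-- **`psortW` is a permutation.** -/
theorem psortW_perm (p : PPoly) : (psortW p).Perm p := by
  unfold psortW
  have h := pmergeAll_perm p.length p.length (p.map fun t => [t])
  rwa [flatten_map_singleton] at h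

/-- Sorted for the merge order. -/
def SortedP (l : PPoly) : Prop := l.Pairwise fun a b => ple a b = true

/-- Strictly sorted by word. -/
def StrictP (l : PPoly) : Prop := l.Pairwise fun a b => pwordLt a.2 b.2 = true

/-- A fuelled merge of sorted lists is sorted. -/
theorem pmergeF_sorted (n : ℕ) (p q : PPoly) (hn : p.length + q.length ≤ n) (hp : SortedP p) (hq : SortedP q) :
    SortedP (pmergeF n p q) := by
  rw [pmergeF_eq_merge n p q hn]
  exact List.pairwise_merge ple_trans ple_total p q hp hq

/-- The work-list's total length is invariant under a pairing round. -/
theorem pmergePairs_length_sum (n : ℕ) : ∀ (L : List PPoly),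
    ((pmergePairs n L).map List.length).sum = (L.map List.length).sum
  | [] => rfl
  | [p] => rfl
  | p :: q :: rest => by
    rw [pmergePairs, List.map_cons, List.sum_cons, pmergePairs_length_sum n rest, (pmergeF_perm n p q).length_eq,
      List.length_append]
    simp [Nat.add_assoc]

/-- A pairing round keeps every list sorted (fuel = total length bound). -/
theorem pmergePairs_sorted (n : ℕ) : ∀ (L : List PPoly), (∀ l ∈ L, SortedP l) → (L.map List.length).sum ≤ n →
    ∀ l ∈ pmergePairs n L, SortedP l
  | [], _, _ => by simp [pmergePairs]
  | [p], hL, _ => by simpa [pmergePairs] using hL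
  | p :: q :: rest, hL, hn => by
    intro l hl
    rw [pmergePairs, List.mem_cons] at hl
    simp only [List.map_cons, List.sum_cons] at hn
    rcases hl with rfl | hl
    · exact pmergeF_sorted n p q (by omega) (hL p (by simp)) (hL q (by simp))
    · exact pmergePairs_sorted n rest (fun l' hl' => hL l' (by simp [hl'])) (by omega) l hl

/-- A pairing round never lengthens the work-list … -/
theorem pmergePairs_length_le (n : ℕ) : ∀ (L : List PPoly), (pmergePairs n L).length ≤ L.length
  | [] => le_rfl
  | [p] => le_rfl
  | p :: q :: rest => by
    rw [pmergePairs, List.length_cons, List.length_cons, List.length_cons]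
    have := pmergePairs_length_le n rest
    omega

/-- … and strictly shortens it while two lists remain. -/
theorem pmergePairs_length_lt (n : ℕ) : ∀ (L : List PPoly), 2 ≤ L.length → (pmergePairs n L).length < L.length
  | [], h => by simp at h
  | [p], h => by simp at h
  | p :: q :: rest, _ => by
    rw [pmergePairs, List.length_cons, List.length_cons, List.length_cons]
    have := pmergePairs_length_le n rest
    omega

/-- The driver returns a sorted list when the rounds fuel covers the work-list. -/
theorem pmergeAll_sorted : ∀ (k n : ℕ) (L : List PPoly), (∀ l ∈ L, SortedP l) → (L.map List.length).sum ≤ n →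
    L.length ≤ k + 1 → SortedP (pmergeAll k n L)
  | 0, n, [], _, _, _ => by simp [pmergeAll, SortedP]
  | 0, n, [p], hL, _, _ => by simpa [pmergeAll] using hL p (by simp)
  | 0, n, p :: q :: rest, _, _, hk => by simp at hk
  | k + 1, n, [], _, _, _ => by simp [pmergeAll, SortedP]
  | k + 1, n, [p], hL, _, _ => by simpa [pmergeAll] using hL p (by simp)
  | k + 1, n, p :: q :: rest, hL, hn, hk => by
    rw [pmergeAll]
    · refine pmergeAll_sorted k n _ (pmergePairs_sorted n _ hL hn) (by rw [pmergePairs_length_sum]; exact hn) ?_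
      have := pmergePairs_length_lt n (p :: q :: rest) (by simp)
      omega
    · intro h; simp at h
    · intro p' h; simp at h

/-- **`psortW` is sorted** for the merge order. -/
theorem psortW_sorted (p : PPoly) : SortedP (psortW p) := by
  unfold psortW
  refine pmergeAll_sorted p.length p.length _ (fun l hl => ?_) ?_ (by simp)
  · obtain ⟨t, _, rfl⟩ := List.mem_map.1 hl
    simp [SortedP]
  · have : ((p.map fun t => [t]).map List.length).sum = p.length := by
      rw [List.map_map]
      induction p with
      | nil => rfl
      | cons t p ih => simp [List.sum_cons, ih, Nat.add_comm]
    rw [this]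

end Summit.Ventures.CertifiedManyBodySolver.Theorems.SymReplay.PackedNF
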